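import Summits.BirchSwinnertonDyer.BirchSwinnertonDyer.Theorems.CyclotomicUntwistWildThreeTameTorsionCellLaw
import HarnessLib

/-!
# Two `ℚ₃`-rational stable lines force a CUBE discriminant: `Ψ₃` with two roots `r ≠ r'` in a domain
# gives `Δ = −(2b₄ + b₂(r + r') + 3(r + r')²)³`; hence SPLIT at `3` ⟹ `3 ∣ v₃Δ_min` and
# `Δ_min/3^{v₃Δ_min} ≡ ±1 (mod 9)`

Cell `pub/bsd-wall` (D-0145 line `route-BirchSwinnertonDyer-CyclotomicUntwist`), seat `bsd-line-cycu-p2`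
(prover seat 2/3, gen 4); helper toward K1/K2 (stmt-BirchSwinnertonDyer-21580 / 21581) and the O6 lane
(V10 shapes of `W[3]|G_{ℚ₃}`, `Additive/WildThreeResidualShape*.lean`). THEOREMS ONLY (no definition, no
named fact, no `sorry`); BSD is not proved by this file and no crux is.

## What
* §1 (any integral domain) **`Δ_eq_neg_cube_of_Ψ₃_roots`**: if the `3`-division polynomial
  `Ψ₃ = 3x⁴ + b₂x³ + 3b₄x² + 3b₆x + b₈` has two distinct roots `r ≠ r'`, then
  `Δ = −(2b₄ + b₂(r + r') + 3(r + r')²)³` — an explicit `linear_combination` of the two divided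
  differences of the root equations and the `b`-relation `4b₈ = b₂b₆ − b₄²` (the resolvent cubic of `Ψ₃/3`
  is `(θ − b₄/3)³ + Δ/27`, Serre 1972 §5.3 / the tree's `ThreeTorsionRadicalsProofs`; here the resolvent root
  `θ = rr' + ss'` is written through `r + r'` alone). So two rational stable lines in `E[3]` make `Δ` a cube.
* §2 (`ℚ₃`) **`cube_class_of_intCast_eq_cube`**: an integer `n = 3ʷ·u`, `3 ∤ u`, which is a cube in `ℚ₃`
  has `3 ∣ w` and `u ≡ ±1 (mod 9)` (cubes of `ℤ₃ˣ` reduce to `±1` in `ℤ/9`, a `decide`).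
* §3 (curves over `ℚ`) **`three_dvd_and_mod_nine_of_shapeSplitThree`**: for `W/ℚ` globally minimal,
  `ShapeSplitThree W` (two `ℚ₃`-roots of `Ψ₃`) ⟹ `3 ∣ v₃(Δ_min)` and `Δ_min/3^{v₃Δ_min} % 9 ∈ {1, 8}`;
  on the wild cell (`ClassO6 W 3`) this re-derives the SPLIT half of `WildThreeTameTorsionCellLaw` without
  Tate's algorithm (`v ∈ {3, 9}`, `shapeSplitThree_cell`) and REFINES it by the congruence
  `Δ′ ≡ ±1 (mod 9)` (`Δ′ = Δ_min/3^v`), halving the tame-torsion cells.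
Census (EVIDENCE, not used): on all 64 687 curves with `N < 10⁴` (any reduction at `3`) and all 13 978
wild curves with `N < 3·10⁴`, `#ℚ₃-roots(Ψ₃) ≠ 1 ⟺ Δ_min ∈ (ℚ₃ˣ)³`, 0 exceptions (seat folder
`census/cube_law_check.py`); the converse direction and the IRR rows are local Galois theory (image a
`2`-group iff `∛Δ ∈ ℚ₃`), not claimed here.
References: J.-P. Serre, Invent. Math. 15 (1972) §5.3 (`ℚ(E[3]) ⊃ ℚ(μ₃, ∛Δ)`) [Serre1972]; J. H. Silverman,
*AEC* (2009) III.1, Ex. 3.7 [SilvermanAEC2009]; J.-P. Serre, *Cours d'arithmétique* II §3.3 [Serre1973].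
-/

set_option autoImplicit false
-- single-conjunct summit: `Summit.BirchSwinnertonDyer.BirchSwinnertonDyer.…` repeats the name by design
set_option linter.dupNamespace false

noncomputable section

open scoped Classical

open Polynomial WeierstrassCurve Literature.NumberTheory.EllipticCurves
  Literature.NumberTheory.EllipticCurves.Rank1Residual
  Summit.BirchSwinnertonDyer.Rank1Residual.Additive Summit.BirchSwinnertonDyer.Rank1Residual.O5
  Summit.BirchSwinnertonDyer.Rank1Residual.GaloisImage.LocalTorsion3

namespace Summit.BirchSwinnertonDyer.BirchSwinnertonDyer.Theorems.PSLocalThreeTorsion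

/-! ## §1 Two roots of `Ψ₃` make `Δ` a cube (any integral domain) -/

section Domain

variable {R : Type*} [CommRing R] [IsDomain R] (X : WeierstrassCurve R)

/-- **`Δ = −(2b₄ + b₂(r + r') + 3(r + r')²)³` when `Ψ₃(r) = Ψ₃(r') = 0`, `r ≠ r'`.** The divided
differences `(Ψ₃(r) − Ψ₃(r'))/(r − r')` and `(r'Ψ₃(r) − rΨ₃(r'))/(r − r')` vanish; together with
`4b₈ = b₂b₆ − b₄²` they give the identity by an explicit polynomial combination (the rational resolvent
root of `Ψ₃/3` attached to the pair `{r, r'}`). [cite: Serre1972, §5.3] [cite: SilvermanAEC2009, Exercise 3.7] -/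
theorem Δ_eq_neg_cube_of_Ψ₃_roots {r r' : R} (hne : r ≠ r') (hr : X.Ψ₃.eval r = 0)
    (hr' : X.Ψ₃.eval r' = 0) : X.Δ = -(2 * X.b₄ + X.b₂ * (r + r') + 3 * (r + r') ^ 2) ^ 3 := by
  rw [WeierstrassCurve.eval_Ψ₃_eq] at hr hr'
  have hsub : r - r' ≠ 0 := sub_ne_zero.mpr hne
  have hE1 : 3 * (r ^ 3 + r ^ 2 * r' + r * r' ^ 2 + r' ^ 3) + X.b₂ * (r ^ 2 + r * r' + r' ^ 2) +
      3 * X.b₄ * (r + r') + 3 * X.b₆ = 0 := by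
    have h : (r - r') * (3 * (r ^ 3 + r ^ 2 * r' + r * r' ^ 2 + r' ^ 3) +
        X.b₂ * (r ^ 2 + r * r' + r' ^ 2) + 3 * X.b₄ * (r + r') + 3 * X.b₆) =
        (3 * r ^ 4 + X.b₂ * r ^ 3 + 3 * X.b₄ * r ^ 2 + 3 * X.b₆ * r + X.b₈) -
          (3 * r' ^ 4 + X.b₂ * r' ^ 3 + 3 * X.b₄ * r' ^ 2 + 3 * X.b₆ * r' + X.b₈) := by ring
    rw [hr, hr', sub_zero, mul_eq_zero] at h
    exact h.resolve_left hsub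
  have hE2 : 3 * (r * r') * (r ^ 2 + r * r' + r' ^ 2) + X.b₂ * (r * r') * (r + r') +
      3 * X.b₄ * (r * r') - X.b₈ = 0 := by
    have h : (r - r') * (3 * (r * r') * (r ^ 2 + r * r' + r' ^ 2) + X.b₂ * (r * r') * (r + r') +
        3 * X.b₄ * (r * r') - X.b₈) =
        r' * (3 * r ^ 4 + X.b₂ * r ^ 3 + 3 * X.b₄ * r ^ 2 + 3 * X.b₆ * r + X.b₈) -
          r * (3 * r' ^ 4 + X.b₂ * r' ^ 3 + 3 * X.b₄ * r' ^ 2 + 3 * X.b₆ * r' + X.b₈) := by ring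
    rw [hr, hr', mul_zero, mul_zero, sub_zero, mul_eq_zero] at h
    exact h.resolve_left hsub
  have hrel := X.b_relation
  rw [show X.Δ = -X.b₂ ^ 2 * X.b₈ - 8 * X.b₄ ^ 3 - 27 * X.b₆ ^ 2 + 9 * X.b₂ * X.b₄ * X.b₆ from rfl]
  linear_combination
    (9 * (r ^ 3 + r ^ 2 * r' + r * r' ^ 2 + r' ^ 3) - 9 * X.b₆ + 9 * X.b₄ * (r + r') +
        6 * X.b₂ * (r ^ 2 + r' ^ 2) + 9 * X.b₂ * (r * r') + 3 * X.b₂ * X.b₄ + X.b₂ ^ 2 * (r + r')) * hE1 +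
      (X.b₂ + 6 * (r + r')) ^ 2 * hE2 + (9 * (r + r') ^ 2 + 3 * X.b₂ * (r + r')) * hrel

/-- Hence two distinct roots of `Ψ₃` make the discriminant a CUBE. [cite: Serre1972, §5.3] -/
theorem exists_Δ_eq_cube_of_Ψ₃_roots {r r' : R} (hne : r ≠ r') (hr : X.Ψ₃.eval r = 0)
    (hr' : X.Ψ₃.eval r' = 0) : ∃ d : R, X.Δ = d ^ 3 :=
  ⟨-(2 * X.b₄ + X.b₂ * (r + r') + 3 * (r + r') ^ 2), by
    rw [Δ_eq_neg_cube_of_Ψ₃_roots X hne hr hr']; ring⟩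

end Domain

/-! ## §2 Cube classes of integers in `ℚ₃` -/

section Padic

/-- Cubes in `ℤ/9` are `0`, `1`, `8`. [folklore] -/
theorem zmod_nine_cube (x : ZMod 9) : x ^ 3 = 0 ∨ x ^ 3 = 1 ∨ x ^ 3 = 8 := by
  revert x; decide

/-- **Cube classes of integers in `ℚ₃`.** If `n = 3ʷ · u` with `3 ∤ u` is a cube in `ℚ₃`, then `3 ∣ w`
and `u ≡ ±1 (mod 9)` (the cube root has valuation `w/3`; cubes of `3`-adic units are `±1 (mod 9)`).
[cite: Serre1973, Ch. II §3.3] -/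
theorem cube_class_of_intCast_eq_cube (n : ℤ) (w : ℕ) (hw : (3 : ℤ) ^ w ∣ n)
    (hw' : ¬ (3 : ℤ) ^ (w + 1) ∣ n) {d : ℚ_[3]} (hd : (n : ℚ_[3]) = d ^ 3) :
    3 ∣ w ∧ ((n / 3 ^ w) % 9 = 1 ∨ (n / 3 ^ w) % 9 = 8) := by
  obtain ⟨u, hu⟩ := hw
  have h3w : (3 : ℤ) ^ w ≠ 0 := pow_ne_zero _ (by norm_num)
  have hdiv : n / 3 ^ w = u := by rw [hu, Int.mul_ediv_cancel_left _ h3w]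
  have hu3 : ¬ (3 : ℤ) ∣ u := by
    rintro ⟨v, rfl⟩; exact hw' ⟨v, by rw [hu]; ring⟩
  have hn0 : (n : ℚ_[3]) ≠ 0 := by
    have : n ≠ 0 := by rintro rfl; exact hw' (dvd_zero _)
    exact_mod_cast this
  have hd0 : d ≠ 0 := fun h0 ↦ hn0 (by rw [hd, h0]; ring)
  -- valuation: `‖n‖ = 3^{-w} = ‖d‖³ = 3^{-3v}`
  have hnn : ‖(n : ℚ_[3])‖ = (3 : ℝ) ^ (-(w : ℤ)) := norm_intCast_padic_eq ⟨u, hu⟩ hw'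
  have hdv := Padic.norm_eq_zpow_neg_valuation hd0
  set v := d.valuation with hv
  have hw3 : (w : ℤ) = 3 * v := by
    have : ((3 : ℕ) : ℝ) ^ (-(w : ℤ)) = ((3 : ℕ) : ℝ) ^ (-v + -v + -v) := by
      rw [zpow_add₀ (by norm_num), zpow_add₀ (by norm_num), ← hdv, ← norm_mul, ← norm_mul,
        show d * d * d = d ^ 3 by ring, ← hd]
      exact_mod_cast hnn.symm
    have hinj := (zpow_right_injective₀ (a := ((3 : ℕ) : ℝ)) (by norm_num) (by norm_num)) this
    omega
  refine ⟨⟨v.toNat, by omega⟩, ?_⟩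
  -- unit part: `u = ρ³` with `ρ = d / 3^v` a unit
  set ρ : ℚ_[3] := d / (3 : ℚ_[3]) ^ v with hρ
  have hρn : ‖ρ‖ = 1 := by
    have h3 : ‖(3 : ℚ_[3])‖ = 3⁻¹ := by exact_mod_cast Padic.norm_p (p := 3)
    rw [hρ, norm_div, norm_zpow, hdv, h3, inv_zpow']
    push_cast
    exact div_self (zpow_ne_zero _ (by norm_num))
  have huρ : (u : ℚ_[3]) = ρ ^ 3 := by
    have hn' : (n : ℚ_[3]) = (3 : ℚ_[3]) ^ (w : ℤ) * u := by
      rw [hu]; push_cast; rw [zpow_natCast]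
    have : (u : ℚ_[3]) = (n : ℚ_[3]) / (3 : ℚ_[3]) ^ (w : ℤ) := by
      rw [hn', mul_div_cancel_left₀ _ (zpow_ne_zero _ (by norm_num))]
    rw [this, hd, hρ, hw3, div_pow, ← zpow_natCast ((3 : ℚ_[3]) ^ v) 3, ← zpow_mul]
    push_cast
    ring_nf
  -- reduce modulo `9` inside `ℤ₃`
  set P : ℤ_[3] := ⟨ρ, hρn.le⟩ with hP
  have hUP : ((u : ℤ_[3]) : ℚ_[3]) = ((P ^ 3 : ℤ_[3]) : ℚ_[3]) := by
    rw [PadicInt.coe_pow]; push_cast; rw [huρ]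
  have hUP' : (u : ℤ_[3]) = P ^ 3 := Subtype.ext hUP
  have hφ : ((u : ℤ) : ZMod (3 ^ 2)) = (PadicInt.toZModPow 2 P) ^ 3 := by
    rw [← map_pow, ← hUP', map_intCast]
  -- `u mod 9` is a cube, and `3 ∤ u`
  rw [hdiv]
  set m : ℤ := u % 9 with hm
  have hm0 : 0 ≤ m := Int.emod_nonneg u (by norm_num)
  have hm9 : m < 9 := Int.emod_lt_of_pos u (by norm_num)
  have hm3 : m % 3 ≠ 0 := by
    rw [hm, Int.emod_emod_of_dvd u (by norm_num : (3 : ℤ) ∣ 9)]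
    intro h; exact hu3 (Int.dvd_of_emod_eq_zero h)
  have hmc : ((m : ℤ) : ZMod 9) = (PadicInt.toZModPow 2 P) ^ 3 := by
    have hmu : ((m : ℤ) : ZMod 9) = (u : ZMod 9) := by rw [hm]; exact_mod_cast ZMod.intCast_mod u 9
    rw [hmu]; exact hφ
  rcases zmod_nine_cube (PadicInt.toZModPow 2 P) with h | h | h <;> rw [h] at hmc <;>
    interval_cases m <;> first | (left; rfl) | (right; rfl) | (exfalso; revert hmc; decide) |
      (exfalso; exact hm3 rfl)

end Padic

/-! ## §3 Curves over `ℚ`: SPLIT at `3` forces a cube discriminant -/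

section Curves

variable (W : WeierstrassCurve ℚ) [W.IsElliptic]

omit [W.IsElliptic] in
/-- **SPLIT ⟹ `Δ` is a cube in `ℚ₃`** (two `ℚ₃`-roots of `Ψ₃`; any model of any `E/ℚ`).
[cite: Serre1972, §5.3] -/
theorem exists_cube_eq_Δ_of_shapeSplitThree (h : ShapeSplitThree W) :
    ∃ d : ℚ_[3], (W.Δ : ℚ_[3]) = d ^ 3 := by
  obtain ⟨r, r', hne, hr, hr'⟩ := h
  obtain ⟨d, hd⟩ := exists_Δ_eq_cube_of_Ψ₃_roots (W.baseChange ℚ_[3]) hne hr hr'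
  refine ⟨d, ?_⟩
  rw [← hd, WeierstrassCurve.baseChange, WeierstrassCurve.map_Δ]
  rfl

variable [W.IsGloballyMinimal]

/-- **SPLIT at `3` ⟹ `3 ∣ v₃(Δ_min)` and `Δ_min/3^{v₃Δ_min} ≡ ±1 (mod 9)`** (globally minimal `W`:
`Δ = Δ_min`). [cite: Serre1972, §5.3] [cite: Serre1973, Ch. II §3.3] -/
theorem three_dvd_and_mod_nine_of_shapeSplitThree (h : ShapeSplitThree W) :
    3 ∣ padicValInt 3 W.minimalDiscriminantInt ∧
      (W.minimalDiscriminantInt / 3 ^ padicValInt 3 W.minimalDiscriminantInt % 9 = 1 ∨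
        W.minimalDiscriminantInt / 3 ^ padicValInt 3 W.minimalDiscriminantInt % 9 = 8) := by
  obtain ⟨d, hd⟩ := exists_cube_eq_Δ_of_shapeSplitThree W h
  set n : ℤ := W.minimalDiscriminantInt with hn
  have hn0 : n ≠ 0 := by
    intro h0
    have hΔ : W.Δ ≠ 0 := W.coe_Δ' ▸ W.Δ'.ne_zero
    apply hΔ
    rw [← cast_minimalDiscriminantInt, ← hn, h0, Int.cast_zero]
  have hcast : (W.Δ : ℚ_[3]) = ((n : ℚ) : ℚ_[3]) := by rw [hn, cast_minimalDiscriminantInt]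
  have hdvd : (3 : ℤ) ^ padicValInt 3 n ∣ n := by exact_mod_cast padicValInt_dvd (p := 3) n
  have hndvd : ¬ (3 : ℤ) ^ (padicValInt 3 n + 1) ∣ n := by
    intro h'
    have := (padicValInt_dvd_iff (padicValInt 3 n + 1) n).mp (by exact_mod_cast h')
    omega
  have hd' : (n : ℚ_[3]) = d ^ 3 := by rw [← hd, hcast, Rat.cast_intCast]
  exact cube_class_of_intCast_eq_cube n _ hdvd hndvd hd'

/-- **On the wild cell, SPLIT lives on `v₃Δ_min ∈ {3, 9}` with `Δ_min/3^v ≡ ±1 (mod 9)`** — the SPLIT half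
of the tame-torsion cell law re-derived without Tate's algorithm (`3 ∣ v` from the cube; `v` even is the
one-stable-line locus of gen 3's `exists_isUniqueStableLineThree_of_psRow`) and refined by the cube class.
[cite: Serre1972, §5.3] [cite: Kraus1990, Théorème (p = 3)] -/
theorem shapeSplitThree_cell (hO6 : ClassO6 W 3) (h : ShapeSplitThree W) :
    (padicValInt 3 W.minimalDiscriminantInt = 3 ∨ padicValInt 3 W.minimalDiscriminantInt = 9) ∧
      (W.minimalDiscriminantInt / 3 ^ padicValInt 3 W.minimalDiscriminantInt % 9 = 1 ∨
        W.minimalDiscriminantInt / 3 ^ padicValInt 3 W.minimalDiscriminantInt % 9 = 8) := by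
  obtain ⟨h3, h9⟩ := three_dvd_and_mod_nine_of_shapeSplitThree W h
  refine ⟨?_, h9⟩
  have hne : ∀ x₀, ¬ IsUniqueStableLineThree W x₀ := by
    obtain ⟨r, r', hrr, hr, hr'⟩ := h
    exact fun x₀ hx ↦ hrr ((hx.2 r hr).trans (hx.2 r' hr').symm)
  have hodd : ¬ Even (padicValInt 3 W.minimalDiscriminantInt) := by
    intro hev
    obtain ⟨x₀, hx⟩ := exists_isUniqueStableLineThree_of_psRow W hO6 hev
    exact hne x₀ hx
  rcases PSKodairaDictionary.kodairaSymbolAt_windows W hO6.2.1 hO6.2.2 with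
    ⟨-, h1, h2, -⟩ | ⟨-, h1, h2, -⟩ | ⟨-, h1, h2, -⟩ | ⟨-, h1, h2, -⟩
  all_goals
    rw [Nat.even_iff] at hodd
    omega

end Curves

end Summit.BirchSwinnertonDyer.BirchSwinnertonDyer.Theorems.PSLocalThreeTorsion

end
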